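import Mathlib
import HarnessLib

/-!
# Crux `SplitBlockJacobi` (stmt-Parity-11583, route `IsogenyRedei`), line
# `cofactor-root-discrepancy`: the corner implication `MixedBilinear(δ₀) ⇒ TierWeylBound θ μ`
# for `μ ≥ 1 - δ₀/3` (support for `stub_weylShallow`)

Support for the OPEN stub `stub_weylShallow` (`∀ θ μ, 1/2 < θ < 1 → 2/3 ≤ μ < 1 →
TierWeylBound θ μ`); the stub itself is NOT proved here.  What is proved is the exponent
bookkeeping reducing the corner `μ → 1` of `TierWeylBound` to the clean bilinear hypothesis

  `MB(δ₀)`: there is `P₀` such that for every box `P₀ ≤ P₁ ≤ P₁' ≤ 2P₁`, `P₁ ≤ P₂ ≤ P₂' ≤ 2P₂`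
  and every frequency `0 < |h| ≤ (P₁P₂)^{δ₀}`:  `‖T_h((P₁,P₁'] × (P₂,P₂'])‖ ≤ (P₁P₂)^{1-δ₀}`,

where `T_h` is the skeleton's `twistedSum h P₁ P₁' P₂ P₂'` (the twisted root Weyl sum
`Σ_{Q,Q'} (Q|Q') S(h, QQ')` over primes `≡ 1 (mod 4)`), namely

  `tierWeylBound_of_mixedBilinear` (registered sub-goal):
  `0 < δ₀ ≤ 1`, `MB(δ₀)` ⟹ `∀ θ μ, 1/2 < θ → θ < 1 → 1 - δ₀/3 ≤ μ → μ < 1 → TierWeylBound θ μ`.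

Everything is stated DEF-FREE (the bodies of `rootWeylSum`, `twistedSum`, `TierWeylBound` are
pasted in place of the names), so the lead obtains `TierWeylBound θ μ` by `exact`.

Also: the frequency symmetry `S(-h, q) = conj S(h, q)`, `T_{-h} = conj T_h`, `‖T_{-h}‖ = ‖T_h‖`
(`Weyl.rootWeylSum_neg`, `Weyl.twistedSum_neg`, `Weyl.norm_twistedSum_neg`), whence the variant
`Weyl.tierWeylBound_of_mixedBilinear_pos` assuming `MB(δ₀)` for POSITIVE frequencies `h ≥ 1` only
(the convention of Duke–Friedlander–Iwaniec 1995).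

Proof (pure exponent bookkeeping): take `ε₀ := δ₀/3` and `x₀ := 4P₀² + 1`.  Given an admissible
box (`x^θ ≤ 2P₁`, `N := P₁P₂ ≤ x^{2-μ} ≤ x^{1+δ₀/3}`) and `h ≠ 0` with `|h| ≤ N x^{ε₀-1}`:
`P₁ ≥ P₀` (else `√x ≤ x^θ < 2P₀`), and `|h| ≤ N x^{ε₀-1} ≤ N^{δ₀}` because
`N^{1-δ₀} ≤ x^{(2-μ)(1-δ₀)} ≤ x^{1-ε₀}` (`(1+δ₀/3)(1-δ₀) = 1 - 2δ₀/3 - δ₀²/3 ≤ 1 - δ₀/3`);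
so `MB` gives `‖T_h‖ ≤ N^{1-δ₀} ≤ x^{1-ε₀}`.
-/

/- LOG (stub-worker w-weylShallow):
  proved here: (A) Weyl.tierWeylBound_of_mixedBilinear (+ the rpow bookkeeping lemma
  Weyl.rpow_budget), the symmetry h ↦ -h (Weyl.rootWeylSum_neg, twistedSum_neg,
  norm_twistedSum_neg) and the positive-frequency variant Weyl.tierWeylBound_of_mixedBilinear_pos.
  tierWeylBound_of_mixedBilinear is stated in ∀-form in the parent namespace and registered as a
  sub-goal stub of stmt-Parity-11583 (the gate's supports.stub-mismatch rule: first real proposal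
  p83132 bounced because a --supports file must prove a REGISTERED stub by name+signature;
  registered with `ledger workitem stub-add stmt-Parity-11583 --name tierWeylBound_of_mixedBilinear
  --signature @logs/sig_tierWeylBound_of_mixedBilinear.txt`).
  (B), (C) are in work/stubs/RootWeylSumCRT.lean.
  stub_weylShallow itself: OPEN (MixedBilinear), not attempted. -/

noncomputable section

open scoped ComplexConjugate

namespace Summit.Parity.BatemanHorn.Cruxes.SplitBlockJacobi.CofactorRootDiscrepancy

namespace Weyl

/-- The exponent budget: for `x ≥ 1`, `0 < N ≤ x^{2-μ}`, `0 < δ₀ ≤ 1`, `1 - δ₀/3 ≤ μ`: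
`N · x^{δ₀/3 - 1} ≤ N^{δ₀}` and `N^{1-δ₀} ≤ x^{1-δ₀/3}`. [folklore] -/
theorem rpow_budget {δ₀ μ x N : ℝ} (hδ₀ : 0 < δ₀) (hδ₁ : δ₀ ≤ 1) (hμ : 1 - δ₀ / 3 ≤ μ)
    (hx : 1 ≤ x) (hN : 0 < N) (hNx : N ≤ x ^ (2 - μ)) :
    N * x ^ (δ₀ / 3 - 1) ≤ N ^ δ₀ ∧ N ^ (1 - δ₀) ≤ x ^ (1 - δ₀ / 3) := by
  have hx0 : 0 < x := one_pos.trans_le hx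
  have key : N ^ (1 - δ₀) ≤ x ^ (1 - δ₀ / 3) := by
    have hexp : (2 - μ) * (1 - δ₀) ≤ 1 - δ₀ / 3 := by
      nlinarith [mul_le_mul_of_nonneg_right (show 2 - μ ≤ 1 + δ₀ / 3 by linarith)
        (show (0 : ℝ) ≤ 1 - δ₀ by linarith), sq_nonneg δ₀]
    calc N ^ (1 - δ₀) ≤ (x ^ (2 - μ)) ^ (1 - δ₀) :=
          Real.rpow_le_rpow hN.le hNx (by linarith)
      _ = x ^ ((2 - μ) * (1 - δ₀)) := by rw [← Real.rpow_mul hx0.le]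
      _ ≤ x ^ (1 - δ₀ / 3) := Real.rpow_le_rpow_of_exponent_le hx hexp
  refine ⟨?_, key⟩
  have hsplit : N = N ^ δ₀ * N ^ (1 - δ₀) := by
    rw [← Real.rpow_add hN]; norm_num
  have hxinv : x ^ (δ₀ / 3 - 1) = (x ^ (1 - δ₀ / 3))⁻¹ := by
    rw [← Real.rpow_neg hx0.le]; congr 1; ring
  have hxpos : 0 < x ^ (1 - δ₀ / 3) := Real.rpow_pos_of_pos hx0 _
  calc N * x ^ (δ₀ / 3 - 1) = N ^ δ₀ * (N ^ (1 - δ₀) * (x ^ (1 - δ₀ / 3))⁻¹) := by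
        rw [hxinv]
        conv_lhs => rw [hsplit]
        ring
    _ ≤ N ^ δ₀ * (x ^ (1 - δ₀ / 3) * (x ^ (1 - δ₀ / 3))⁻¹) := by
        gcongr
    _ = N ^ δ₀ := by rw [mul_inv_cancel₀ hxpos.ne', mul_one]

end Weyl

/-- **Corner implication** `MixedBilinear(δ₀) ⇒ TierWeylBound θ μ` for every `1/2 < θ < 1` and
`1 - δ₀/3 ≤ μ < 1` (support for the open stub `stub_weylShallow`; registered sub-goal of
stmt-Parity-11583; all skeleton definitions `rootWeylSum`, `twistedSum`, `TierWeylBound`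
expanded).  The third hypothesis is `MB(δ₀)`: the clean bilinear power saving
`‖T_h‖ ≤ (P₁P₂)^{1-δ₀}` for `0 < |h| ≤ (P₁P₂)^{δ₀}` over dyadic-type boxes of primes `≡ 1 (mod 4)`
with `P₁ ≥ P₀`; the conclusion is `TierWeylBound θ μ` with `ε₀ = δ₀/3`. [folklore] -/
theorem tierWeylBound_of_mixedBilinear :
    ∀ {δ₀ : ℝ}, 0 < δ₀ → δ₀ ≤ 1 →
      (∃ P₀ : ℕ, ∀ P₁ P₁' P₂ P₂' : ℕ, P₀ ≤ P₁ → P₁ ≤ P₁' → P₁' ≤ 2 * P₁ → P₁ ≤ P₂ →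
        P₂ ≤ P₂' → P₂' ≤ 2 * P₂ → ∀ h : ℤ, h ≠ 0 → (|h| : ℝ) ≤ ((P₁ * P₂ : ℕ) : ℝ) ^ δ₀ →
          ‖∑ Q ∈ (Finset.Ioc P₁ P₁').filter (fun Q : ℕ => Q.Prime ∧ Q % 4 = 1),
              ∑ Q' ∈ (Finset.Ioc P₂ P₂').filter (fun Q' : ℕ => Q'.Prime ∧ Q' % 4 = 1),
                (jacobiSym (Q : ℤ) Q' : ℂ) *
                  ∑ ν ∈ (Finset.range (Q * Q')).filter (fun ν : ℕ => Q * Q' ∣ ν ^ 2 + 1),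
                    Complex.exp (2 * Real.pi * Complex.I * (h : ℂ) * (ν : ℂ) /
                      ((Q * Q' : ℕ) : ℂ))‖ ≤
            ((P₁ * P₂ : ℕ) : ℝ) ^ (1 - δ₀)) →
      ∀ θ μ : ℝ, 1 / 2 < θ → θ < 1 → 1 - δ₀ / 3 ≤ μ → μ < 1 →
        ∃ ε₀ : ℝ, 0 < ε₀ ∧ ∃ x₀ : ℕ, ∀ x : ℕ, x₀ ≤ x → ∀ P₁ P₁' P₂ P₂' : ℕ,
          (x : ℝ) ^ θ ≤ 2 * (P₁ : ℝ) → P₁ ≤ P₁' → P₁' ≤ 2 * P₁ → P₁ ≤ P₂ → P₂ ≤ P₂' →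
            P₂' ≤ 2 * P₂ → ((P₁ * P₂ : ℕ) : ℝ) ≤ (x : ℝ) ^ (2 - μ) →
              ∀ h : ℤ, h ≠ 0 → (|h| : ℝ) ≤ ((P₁ * P₂ : ℕ) : ℝ) * (x : ℝ) ^ (ε₀ - 1) →
                ‖∑ Q ∈ (Finset.Ioc P₁ P₁').filter (fun Q : ℕ => Q.Prime ∧ Q % 4 = 1),
                    ∑ Q' ∈ (Finset.Ioc P₂ P₂').filter (fun Q' : ℕ => Q'.Prime ∧ Q' % 4 = 1),
                      (jacobiSym (Q : ℤ) Q' : ℂ) *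
                        ∑ ν ∈ (Finset.range (Q * Q')).filter (fun ν : ℕ => Q * Q' ∣ ν ^ 2 + 1),
                          Complex.exp (2 * Real.pi * Complex.I * (h : ℂ) * (ν : ℂ) /
                            ((Q * Q' : ℕ) : ℂ))‖ ≤
                  (x : ℝ) ^ (1 - ε₀) := by
  intro δ₀ hδ₀ hδ₁ hMB
  obtain ⟨P₀, hP₀⟩ := hMB
  intro θ μ hθ _hθ1 hμ _hμ1
  refine ⟨δ₀ / 3, by positivity, 4 * P₀ ^ 2 + 1, ?_⟩
  intro x hx P₁ P₁' P₂ P₂' hxP₁ h₁₁ h₁₂ h₁₃ h₂₂ h₂₃ hN h hh0 hh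
  -- `x ≥ 1`
  have hx1 : (1 : ℝ) ≤ x := by exact_mod_cast (le_add_self.trans hx : 1 ≤ x)
  have hx0 : (0 : ℝ) < x := one_pos.trans_le hx1
  -- `P₀ ≤ P₁`, since `√x ≤ x^θ ≤ 2P₁` and `x > 4P₀²`
  have hP₁ : P₀ ≤ P₁ := by
    by_contra hlt
    push Not at hlt
    have h2 : (2 : ℝ) * P₁ < 2 * P₀ := by
      have : (P₁ : ℝ) + 1 ≤ P₀ := by exact_mod_cast hlt
      linarith
    have hhalf : (x : ℝ) ^ (1 / 2 : ℝ) ≤ (x : ℝ) ^ θ :=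
      Real.rpow_le_rpow_of_exponent_le hx1 hθ.le
    have hlt' : (x : ℝ) ^ (1 / 2 : ℝ) < 2 * P₀ := by linarith
    have hsq : ((x : ℝ) ^ (1 / 2 : ℝ)) ^ 2 = x := by
      rw [← Real.rpow_natCast, ← Real.rpow_mul hx0.le]; norm_num
    have hxlt : (x : ℝ) < (2 * P₀) ^ 2 := by
      rw [← hsq]
      exact pow_lt_pow_left₀ hlt' (Real.rpow_nonneg hx0.le _) two_ne_zero
    have hx' : ((4 * P₀ ^ 2 + 1 : ℕ) : ℝ) ≤ x := by exact_mod_cast hx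
    push_cast at hx'
    linarith
  -- `N := P₁P₂ > 0` (there is an admissible `h ≠ 0`)
  set N : ℝ := ((P₁ * P₂ : ℕ) : ℝ) with hNdef
  have habs1 : (1 : ℝ) ≤ |(h : ℝ)| := by exact_mod_cast Int.one_le_abs hh0
  have hNpos : 0 < N := by
    have hN0 : 0 ≤ N := Nat.cast_nonneg _
    rcases hN0.lt_or_eq with hpos | hzero
    · exact hpos
    · exfalso
      rw [← hzero, zero_mul] at hh
      linarith
  obtain ⟨hbud, hkey⟩ := Weyl.rpow_budget hδ₀ hδ₁ hμ hx1 hNpos hN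
  -- apply `MB`
  exact (hP₀ P₁ P₁' P₂ P₂' hP₁ h₁₁ h₁₂ h₁₃ h₂₂ h₂₃ h hh0 (hh.trans hbud)).trans hkey

namespace Weyl

/-! ### Frequency symmetry `h ↦ -h` and the positive-frequency variant -/

/-- `S(-h, q) = conj S(h, q)` for the root Weyl sum (skeleton's `rootWeylSum`, expanded).
[folklore] -/
theorem rootWeylSum_neg (h : ℤ) (q : ℕ) :
    ∑ ν ∈ (Finset.range q).filter (fun ν : ℕ => q ∣ ν ^ 2 + 1),
        Complex.exp (2 * Real.pi * Complex.I * ((-h : ℤ) : ℂ) * (ν : ℂ) / (q : ℂ)) =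
      conj (∑ ν ∈ (Finset.range q).filter (fun ν : ℕ => q ∣ ν ^ 2 + 1),
        Complex.exp (2 * Real.pi * Complex.I * (h : ℂ) * (ν : ℂ) / (q : ℂ))) := by
  rw [map_sum]
  refine Finset.sum_congr rfl fun ν _ => ?_
  rw [← Complex.exp_conj]
  congr 1
  simp only [map_div₀, map_mul, Complex.conj_ofReal, Complex.conj_I, map_natCast, map_intCast,
    map_ofNat, Int.cast_neg]
  ring

/-- `T_{-h} = conj T_h` for the twisted root Weyl sum (skeleton's `twistedSum`, expanded): the
Jacobi symbol is real. [folklore] -/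
theorem twistedSum_neg (h : ℤ) (P₁ P₁' P₂ P₂' : ℕ) :
    ∑ Q ∈ (Finset.Ioc P₁ P₁').filter (fun Q : ℕ => Q.Prime ∧ Q % 4 = 1),
        ∑ Q' ∈ (Finset.Ioc P₂ P₂').filter (fun Q' : ℕ => Q'.Prime ∧ Q' % 4 = 1),
          (jacobiSym (Q : ℤ) Q' : ℂ) *
            ∑ ν ∈ (Finset.range (Q * Q')).filter (fun ν : ℕ => Q * Q' ∣ ν ^ 2 + 1),
              Complex.exp (2 * Real.pi * Complex.I * ((-h : ℤ) : ℂ) * (ν : ℂ) /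
                ((Q * Q' : ℕ) : ℂ)) =
      conj (∑ Q ∈ (Finset.Ioc P₁ P₁').filter (fun Q : ℕ => Q.Prime ∧ Q % 4 = 1),
        ∑ Q' ∈ (Finset.Ioc P₂ P₂').filter (fun Q' : ℕ => Q'.Prime ∧ Q' % 4 = 1),
          (jacobiSym (Q : ℤ) Q' : ℂ) *
            ∑ ν ∈ (Finset.range (Q * Q')).filter (fun ν : ℕ => Q * Q' ∣ ν ^ 2 + 1),
              Complex.exp (2 * Real.pi * Complex.I * (h : ℂ) * (ν : ℂ) / ((Q * Q' : ℕ) : ℂ))) := by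
  rw [map_sum]
  refine Finset.sum_congr rfl fun Q _ => ?_
  rw [map_sum]
  refine Finset.sum_congr rfl fun Q' _ => ?_
  rw [map_mul, map_intCast, rootWeylSum_neg]

/-- `‖T_{-h}‖ = ‖T_h‖` (skeleton's `twistedSum`, expanded). [folklore] -/
theorem norm_twistedSum_neg (h : ℤ) (P₁ P₁' P₂ P₂' : ℕ) :
    ‖∑ Q ∈ (Finset.Ioc P₁ P₁').filter (fun Q : ℕ => Q.Prime ∧ Q % 4 = 1),
        ∑ Q' ∈ (Finset.Ioc P₂ P₂').filter (fun Q' : ℕ => Q'.Prime ∧ Q' % 4 = 1),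
          (jacobiSym (Q : ℤ) Q' : ℂ) *
            ∑ ν ∈ (Finset.range (Q * Q')).filter (fun ν : ℕ => Q * Q' ∣ ν ^ 2 + 1),
              Complex.exp (2 * Real.pi * Complex.I * ((-h : ℤ) : ℂ) * (ν : ℂ) /
                ((Q * Q' : ℕ) : ℂ))‖ =
      ‖∑ Q ∈ (Finset.Ioc P₁ P₁').filter (fun Q : ℕ => Q.Prime ∧ Q % 4 = 1),
        ∑ Q' ∈ (Finset.Ioc P₂ P₂').filter (fun Q' : ℕ => Q'.Prime ∧ Q' % 4 = 1),
          (jacobiSym (Q : ℤ) Q' : ℂ) *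
            ∑ ν ∈ (Finset.range (Q * Q')).filter (fun ν : ℕ => Q * Q' ∣ ν ^ 2 + 1),
              Complex.exp (2 * Real.pi * Complex.I * (h : ℂ) * (ν : ℂ) / ((Q * Q' : ℕ) : ℂ))‖ := by
  rw [twistedSum_neg, Complex.norm_conj]

/-- **Corner implication, positive frequencies**: the same as `tierWeylBound_of_mixedBilinear`,
but with `MB(δ₀)` assumed only for `h ≥ 1` (`T_{-h} = conj T_h` supplies `h ≤ -1`). [folklore] -/
theorem tierWeylBound_of_mixedBilinear_pos {δ₀ : ℝ} (hδ₀ : 0 < δ₀) (hδ₁ : δ₀ ≤ 1)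
    (hMB : ∃ P₀ : ℕ, ∀ P₁ P₁' P₂ P₂' : ℕ, P₀ ≤ P₁ → P₁ ≤ P₁' → P₁' ≤ 2 * P₁ → P₁ ≤ P₂ →
      P₂ ≤ P₂' → P₂' ≤ 2 * P₂ → ∀ h : ℤ, 0 < h → (h : ℝ) ≤ ((P₁ * P₂ : ℕ) : ℝ) ^ δ₀ →
        ‖∑ Q ∈ (Finset.Ioc P₁ P₁').filter (fun Q : ℕ => Q.Prime ∧ Q % 4 = 1),
            ∑ Q' ∈ (Finset.Ioc P₂ P₂').filter (fun Q' : ℕ => Q'.Prime ∧ Q' % 4 = 1),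
              (jacobiSym (Q : ℤ) Q' : ℂ) *
                ∑ ν ∈ (Finset.range (Q * Q')).filter (fun ν : ℕ => Q * Q' ∣ ν ^ 2 + 1),
                  Complex.exp (2 * Real.pi * Complex.I * (h : ℂ) * (ν : ℂ) / ((Q * Q' : ℕ) : ℂ))‖ ≤
          ((P₁ * P₂ : ℕ) : ℝ) ^ (1 - δ₀)) :
    ∀ θ μ : ℝ, 1 / 2 < θ → θ < 1 → 1 - δ₀ / 3 ≤ μ → μ < 1 →
      ∃ ε₀ : ℝ, 0 < ε₀ ∧ ∃ x₀ : ℕ, ∀ x : ℕ, x₀ ≤ x → ∀ P₁ P₁' P₂ P₂' : ℕ,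
        (x : ℝ) ^ θ ≤ 2 * (P₁ : ℝ) → P₁ ≤ P₁' → P₁' ≤ 2 * P₁ → P₁ ≤ P₂ → P₂ ≤ P₂' →
          P₂' ≤ 2 * P₂ → ((P₁ * P₂ : ℕ) : ℝ) ≤ (x : ℝ) ^ (2 - μ) →
            ∀ h : ℤ, h ≠ 0 → (|h| : ℝ) ≤ ((P₁ * P₂ : ℕ) : ℝ) * (x : ℝ) ^ (ε₀ - 1) →
              ‖∑ Q ∈ (Finset.Ioc P₁ P₁').filter (fun Q : ℕ => Q.Prime ∧ Q % 4 = 1),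
                  ∑ Q' ∈ (Finset.Ioc P₂ P₂').filter (fun Q' : ℕ => Q'.Prime ∧ Q' % 4 = 1),
                    (jacobiSym (Q : ℤ) Q' : ℂ) *
                      ∑ ν ∈ (Finset.range (Q * Q')).filter (fun ν : ℕ => Q * Q' ∣ ν ^ 2 + 1),
                        Complex.exp (2 * Real.pi * Complex.I * (h : ℂ) * (ν : ℂ) /
                          ((Q * Q' : ℕ) : ℂ))‖ ≤
                (x : ℝ) ^ (1 - ε₀) := by
  refine tierWeylBound_of_mixedBilinear hδ₀ hδ₁ ?_
  obtain ⟨P₀, hP₀⟩ := hMB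
  refine ⟨P₀, fun P₁ P₁' P₂ P₂' h₀ h₁₁ h₁₂ h₁₃ h₂₂ h₂₃ h hh0 hh => ?_⟩
  rcases lt_or_gt_of_ne hh0 with hneg | hpos
  · -- `h < 0`: use `-h > 0` and `‖T_h‖ = ‖T_{-h}‖`
    have habs : (|h| : ℝ) = ((-h : ℤ) : ℝ) := by
      rw [Int.cast_neg]; exact abs_of_neg (by exact_mod_cast hneg)
    have key := hP₀ P₁ P₁' P₂ P₂' h₀ h₁₁ h₁₂ h₁₃ h₂₂ h₂₃ (-h) (by omega) (habs ▸ hh)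
    have hsymm := norm_twistedSum_neg (-h) P₁ P₁' P₂ P₂'
    rw [neg_neg] at hsymm
    rw [hsymm]
    exact key
  · have habs : (|h| : ℝ) = (h : ℝ) := abs_of_pos (by exact_mod_cast hpos)
    exact hP₀ P₁ P₁' P₂ P₂' h₀ h₁₁ h₁₂ h₁₃ h₂₂ h₂₃ h hpos (habs ▸ hh)

end Weyl

end Summit.Parity.BatemanHorn.Cruxes.SplitBlockJacobi.CofactorRootDiscrepancy
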